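import Summits.QuantumFields.BalabanUV.T4Continuum.Support.NE7MinActHessianFlatCurl
import HarnessLib

/-!
# NE7MinimiserDerivativeFlat — THE DERIVATIVE OF THE MINIMISER SECTION AT THE FLAT DATUM IS A LINEAR RIGHT INVERSE OF THE AVERAGING MAP THAT SOLVES BAŁABAN'S VARIATIONAL PROBLEM
# (ROAD-G115 §5 (i): «∂_V U_k(V)|_{V=1} = the linear minimiser H_k»)

At the flat datum (`V₀ = 1`, `U♯ = 1`), for `0 < ε ≤ ε₀`, `N ≥ 1` and every level `j+1` (`M = L·tower j`, `w = stepWt⁻ʲ⁻¹`, `W` = the plaquettes of the period box) there is a `C¹` section of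
minimisers `y ↦ chart_1 Ψ(y)` over the data `chart_1 y` (`Ψ : skewSub N → skewSub M`, `Ψ 0 = 0`; the slice-gauge section of ✓ `NE7MinimiserC1Lift`) whose derivative at `0`, the continuous
LINEAR map `H := DΨ(0) : skewSub N →L skewSub M`, satisfies for every coarse direction `v`: (a) `levelQ′ 1 (H v) = v` (a right inverse of the linearised `(j+1)`-fold averaging map);
(b) `w·Σ_{p∈W} nhsNormSq(curl_1 (H v) p)` is the LEAST element of `{ w·Σ_{p∈W} nhsNormSq(curl_1 X p) : X ∈ skewSub M, levelQ′ 1 X = v }` — `H v` SOLVES the variational problem defining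
Bałaban's quadratic form; (c) `D²(minAct∘chart_1)(0)[v, v] = w·Σ_{p∈W} nhsNormSq(curl_1 (H v) p)` (**`minimiser_derivative_flat`**).  In words: the linearisation at the flat background of
OUR nonlinear minimiser `U_{j+1}(V)` is the linear operator «minimise the free action under the averaging constraint» — Bałaban's `H_k`-type operator, characterised variationally.
MECHANISM: the package of ✓ `NE7MinActC2Lift.minAct_contDiffAt_two_of_lift` at `(1,1)` (lift hypothesis by `stab_flatCfg_const`), `Ψ := ι_Sl ∘ θ_Σ ∘ (id, ι_K ∘ z⋆)`; (a) by differentiating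
`levelQ(chart θ_Σ p) = p.1`; (c) by the Schur formula (iii) of that package + `fderiv_fderiv_comp_of_fderiv_eq_zero` (`D𝒜(0) = 0` at the flat configuration) + ✓ `flat_second_variation`;
(b) from (a), (c) and ✓ `NE7MinActHessianFlatCurl.minAct_hessian_flat_curl`.
Cell `pub-balaban`, rung (B)+1 sub-cell t4, lineage `b2b-balaban-t4-ne7-p1` (CRUX PROVER NE7 #1 = OWNER of BINDER row NE7), generation 115.  Memo `t4/b2b-balaban-t4-ne7-p1-g115/ROAD-G115.md` §5.
WHAT ([folklore]; 0 def, 0 sorry; `d = 4`, every `U(n)`, `L ≥ 2`).  HONEST FRAMING (page 1): OUR constrained minimisation (B11 (8) with `sfClass`); `H` characterised VARIATIONALLY (no operator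
formula, no decay ∕ spectral bounds, no uniqueness statement, no `k`-uniformity); nothing of Bałaban's asserted; NOT NE7 as a spine node, NOT NE3; spine 0∕9; finite T⁴ rung (B)+1 — NOT
infinite volume, NOT mass gap, NOT BetaPertH, NOT Clay.
-/

set_option autoImplicit false

open scoped BigOperators Matrix Matrix.Norms.L2Operator Topology
open NormedSpace Finset Set Filter Metric

namespace Summit.QuantumFields.BalabanUV.T4Continuum.NE7MinimiserDerivativeFlat

open Literature.MathematicalPhysics.QuantumFieldTheory.Balaban1983to89
open B7Prop1Explicit B7Prop2Explicit
open T4AveragingDeficitWall (IsUnitaryCfg SmallField fineAction curl)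
open T4AveragingDeficitWallBoundary (IsPeriodicCfg)
open AveragingDeficitTorusChart (TDir chart chartDir chart_zero isUnitaryCfg_chart)
open AveragingDeficitChartCalculus (contDiffAt_fineAction_chart)
open AveragingDeficitTwoLevelPrep (skewSub)
open AveragingDeficitMultiLevelPrep (tower levelQ levelQ' tower_ne_zero)
open AveragingDeficitMultiLevelFermat (hasStrictFDerivAt_levelQ)
open MinimalActionLevels (perWin stepWt stepWt_pos fineAction_nonneg)
open MinimalActionSandwich (IsMinimiser minAct)
open MinimalActionRate (sfClass)
open MinimalActionWitness (flatCfg isMinimiser_sfClass_flatCfg flatCfg_mem_sfClass isPeriodicCfg_flatCfg fineAction_flatCfg)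
open MatrixNorms (nhsNormSq)
open NE3FlatHessianCurl (isUnitaryCfg_flatCfg)
open NE3EnergyShapes (IsUnitarySite IsPeriodicSite)
open NE7AdmissibleFibreLHC (chart_id_eq_chart_skewP)
open NE7MinimalOrbitDatumContinuity (thresholds)
open NE7MinimiserC1Flat (stab_flatCfg_const)
open NE7SecondOrderChainRule (fderiv_fderiv_comp_of_fderiv_eq_zero)
open NE7MinActC2Lift (minAct_contDiffAt_two_of_lift)
open NE7MinActHessianFlatCurl (flat_second_variation minAct_hessian_flat_curl)

noncomputable section

variable {n : Type} [Fintype n] [DecidableEq n]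

set_option maxHeartbeats 2400000 in
/-- **THE DERIVATIVE OF THE MINIMISER SECTION AT THE FLAT DATUM SOLVES THE VARIATIONAL PROBLEM** (see the module docstring). [folklore] -/
theorem minimiser_derivative_flat [Nonempty n] {L : ℕ} [NeZero L] (hL : 2 ≤ L) :
    ∃ ε₀ : ℝ, 0 < ε₀ ∧ ∀ ε : ℝ, 0 < ε → ε ≤ ε₀ → ∀ (N : ℕ) [NeZero N], 1 ≤ N → ∀ j : ℕ,
      ∃ Ψ : ↥(skewSub 4 n N) → ↥(skewSub 4 n (L * tower L N j)), ContDiffAt ℝ 1 Ψ 0 ∧ Ψ 0 = 0 ∧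
        (∀ᶠ y : ↥(skewSub 4 n N) in 𝓝 0, IsMinimiser 4 (sfClass 4 L N ε) L N (j + 1)
          (chart (ContinuousLinearMap.id ℝ (Matrix n n ℂ)) N (flatCfg : Site 4 → Fin 4 → (Matrix n n ℂ)ˣ) (y : TDir 4 n N))
          (chart (ContinuousLinearMap.id ℝ (Matrix n n ℂ)) (L * tower L N j) (flatCfg : Site 4 → Fin 4 → (Matrix n n ℂ)ˣ)
            ((Ψ y : ↥(skewSub 4 n (L * tower L N j))) : TDir 4 n (L * tower L N j)))) ∧
        ∀ v : ↥(skewSub 4 n N),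
          levelQ' L N j (flatCfg : Site 4 → Fin 4 → (Matrix n n ℂ)ˣ) ((fderiv ℝ Ψ 0 v : ↥(skewSub 4 n (L * tower L N j))) : TDir 4 n (L * tower L N j)) = v ∧
          IsLeast {q : ℝ | ∃ X : ↥(skewSub 4 n (L * tower L N j)),
              levelQ' L N j (flatCfg : Site 4 → Fin 4 → (Matrix n n ℂ)ˣ) (X : TDir 4 n (L * tower L N j)) = v ∧
              q = ((stepWt 4 L)⁻¹) ^ (j + 1) * ∑ p ∈ perWin 4 (N * L ^ (j + 1)),
                nhsNormSq (curl (flatCfg : Site 4 → Fin 4 → (Matrix n n ℂ)ˣ) (chartDir (ContinuousLinearMap.id ℝ (Matrix n n ℂ)) (L * tower L N j) (X : TDir 4 n (L * tower L N j))) p)}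
            (((stepWt 4 L)⁻¹) ^ (j + 1) * ∑ p ∈ perWin 4 (N * L ^ (j + 1)),
                nhsNormSq (curl (flatCfg : Site 4 → Fin 4 → (Matrix n n ℂ)ˣ) (chartDir (ContinuousLinearMap.id ℝ (Matrix n n ℂ)) (L * tower L N j)
                  ((fderiv ℝ Ψ 0 v : ↥(skewSub 4 n (L * tower L N j))) : TDir 4 n (L * tower L N j))) p)) ∧
          fderiv ℝ (fderiv ℝ (fun y : ↥(skewSub 4 n N) => minAct 4 (sfClass 4 L N ε) L N (j + 1)
              (chart (ContinuousLinearMap.id ℝ (Matrix n n ℂ)) N (flatCfg : Site 4 → Fin 4 → (Matrix n n ℂ)ˣ) (y : TDir 4 n N)))) 0 v v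
            = ((stepWt 4 L)⁻¹) ^ (j + 1) * ∑ p ∈ perWin 4 (N * L ^ (j + 1)),
                nhsNormSq (curl (flatCfg : Site 4 → Fin 4 → (Matrix n n ℂ)ˣ) (chartDir (ContinuousLinearMap.id ℝ (Matrix n n ℂ)) (L * tower L N j)
                  ((fderiv ℝ Ψ 0 v : ↥(skewSub 4 n (L * tower L N j))) : TDir 4 n (L * tower L N j))) p) := by
  have hL1 : 1 ≤ L := by omega
  obtain ⟨ε₁, hε₁, H⟩ := thresholds (n := n) hL
  obtain ⟨ε₂, hε₂, H2⟩ := minAct_contDiffAt_two_of_lift (n := n) hL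
  obtain ⟨ε₃, hε₃, H3⟩ := minAct_hessian_flat_curl (n := n) hL
  refine ⟨min ε₁ (min ε₂ ε₃), lt_min hε₁ (lt_min hε₂ hε₃), fun ε hε hεle N _ hN j => ?_⟩
  obtain ⟨-, -, hls, -⟩ := H ε hε (hεle.trans (min_le_left _ _))
  obtain ⟨δ₂, hδ₂, hC2⟩ := H2 ε hε (hεle.trans ((min_le_right _ _).trans (min_le_left _ _))) N hN
  obtain ⟨-, hleast⟩ := H3 ε hε (hεle.trans ((min_le_right _ _).trans (min_le_right _ _))) N hN j
  set M : ℕ := L * tower L N j with hM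
  haveI : NeZero M := ⟨Nat.mul_ne_zero (NeZero.ne L) (tower_ne_zero L N j)⟩
  set V₀ : Site 4 → Fin 4 → (Matrix n n ℂ)ˣ := flatCfg with hV₀def
  set W := perWin 4 (N * L ^ (j + 1)) with hW
  set w : ℝ := ((stepWt 4 L)⁻¹) ^ (j + 1) with hw
  have hV₀u : IsUnitaryCfg V₀ := isUnitaryCfg_flatCfg
  have hV₀P : IsPeriodicCfg V₀ (N : ℤ) := isPeriodicCfg_flatCfg _
  have hV₀PM : IsPeriodicCfg V₀ ((L : ℤ) * (tower L N j : ℕ)) := isPeriodicCfg_flatCfg _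
  have hUs : IsMinimiser 4 (sfClass 4 L N ε) L N (j + 1) V₀ V₀ := isMinimiser_sfClass_flatCfg hL1 N hε.le (j + 1)
  set x₀ : ℝ := ε / ((L : ℝ) ^ (j + 1)) ^ 2 with hx₀
  have hx₀0 : 0 < x₀ := by positivity
  have hV₀x : SmallField V₀ x₀ := (flatCfg_mem_sfClass (d := 4) (n := n) L N hε.le (j + 1)).2.2
  have hV₀δ : SmallField V₀ δ₂ := by
    have h := (flatCfg_mem_sfClass (d := 4) (n := n) L N hδ₂.le 0).2.2
    simpa using h
  have hlift : ∀ s : Site 4 → (Matrix n n ℂ)ˣ, IsUnitarySite s → IsPeriodicSite s (N : ℤ) → gaugeAct s V₀ = V₀ →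
      ∃ h : Site 4 → (Matrix n n ℂ)ˣ, IsUnitarySite h ∧ IsPeriodicSite h ((N * L ^ (j + 1) : ℕ) : ℤ) ∧ gaugeAct h V₀ = V₀ ∧
        ∀ z : Site 4, h (((L : ℤ) ^ (j + 1)) • z) = s z := fun s hsu hsP hfix =>
    ⟨fun _ => s 0, fun _ => hsu 0, fun _ _ => rfl, by funext x κ; simp only [hV₀def, gaugeAct, flatCfg, mul_one, mul_inv_cancel],
      fun z => (stab_flatCfg_const hsP hfix z).symm⟩
  obtain ⟨Sl, θS, KT, iK, zs, hSlle, hθSc, hθS0, hfib1, hiK, hzsc, hzs0, hkey, -, -, -, hHess, -⟩ :=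
    hC2 V₀ ⟨hV₀u, hV₀P, hV₀δ⟩ j V₀ hUs hlift
  haveI : CompleteSpace ↥Sl := FiniteDimensional.complete ℝ _
  haveI : CompleteSpace ↥KT := FiniteDimensional.complete ℝ _
  haveI : CompleteSpace ↥(skewSub 4 n M) := FiniteDimensional.complete ℝ _
  haveI : CompleteSpace ↥(skewSub 4 n N) := FiniteDimensional.complete ℝ _
  -- the section `Ψ = ι_Sl ∘ θ_Σ ∘ (id, ι_K ∘ z⋆)` and its derivative
  set inclSl : ↥Sl →L[ℝ] ↥(skewSub 4 n M) := LinearMap.toContinuousLinearMap (Submodule.inclusion hSlle) with hinclSl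
  set Γ : ↥(skewSub 4 n N) → ↥(skewSub 4 n N) × ↥Sl := fun y => (y, iK (zs y)) with hΓ
  set Ψ : ↥(skewSub 4 n N) → ↥(skewSub 4 n M) := fun y => inclSl (θS (Γ y)) with hΨ
  have hΨval : ∀ y, ((Ψ y : ↥(skewSub 4 n M)) : TDir 4 n M) = ((θS (y, iK (zs y)) : ↥Sl) : TDir 4 n M) := fun y => rfl
  have hΓ0 : Γ 0 = 0 := by simp only [hΓ, hzs0, map_zero, Prod.mk_zero_zero]
  have hΓc : ContDiffAt ℝ 1 Γ 0 := contDiffAt_id.prodMk (iK.contDiff.contDiffAt.comp 0 hzsc)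
  have hΓd : HasFDerivAt Γ ((ContinuousLinearMap.id ℝ ↥(skewSub 4 n N)).prod (iK.comp (fderiv ℝ zs 0))) 0 :=
    (hasFDerivAt_id (0 : ↥(skewSub 4 n N))).prodMk (iK.hasFDerivAt.comp 0 (hzsc.differentiableAt one_ne_zero).hasFDerivAt)
  have hΨc : ContDiffAt ℝ 1 Ψ 0 := by
    have h1 : ContDiffAt ℝ 1 θS (Γ 0) := by rw [hΓ0]; exact hθSc.of_le (by norm_num)
    exact inclSl.contDiff.contDiffAt.comp 0 (h1.comp 0 hΓc)
  have hΨ0 : Ψ 0 = 0 := by simp only [hΨ, hΓ0, hθS0, map_zero]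
  have hΨd : HasFDerivAt Ψ (inclSl.comp ((fderiv ℝ θS 0).comp ((ContinuousLinearMap.id ℝ ↥(skewSub 4 n N)).prod (iK.comp (fderiv ℝ zs 0))))) 0 := by
    have h1 : ∀ p : ↥(skewSub 4 n N) × ↥Sl, p = 0 → HasFDerivAt θS (fderiv ℝ θS 0) p := fun p hp => by
      rw [hp]; exact (hθSc.differentiableAt (by simp)).hasFDerivAt
    exact inclSl.hasFDerivAt.comp 0 ((h1 _ hΓ0).comp 0 hΓd)
  have hkeyΨ : ∀ᶠ y : ↥(skewSub 4 n N) in 𝓝 0, IsMinimiser 4 (sfClass 4 L N ε) L N (j + 1) (chart (ContinuousLinearMap.id ℝ (Matrix n n ℂ)) N V₀ (y : TDir 4 n N))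
      (chart (ContinuousLinearMap.id ℝ (Matrix n n ℂ)) M V₀ ((Ψ y : ↥(skewSub 4 n M)) : TDir 4 n M)) := hkey.mono fun y hy => by rw [hΨval y]; exact hy
  refine ⟨Ψ, hΨc, hΨ0, hkeyΨ, fun v => ?_⟩
  set ζ : ↥KT := fderiv ℝ zs 0 v with hζ
  set sX : ↥Sl := fderiv ℝ θS 0 (v, iK ζ) with hsX
  have hHv : fderiv ℝ Ψ 0 v = ⟨(sX : TDir 4 n M), hSlle sX.2⟩ := by
    rw [hΨd.fderiv]
    apply Subtype.ext
    simp only [ContinuousLinearMap.comp_apply, ContinuousLinearMap.prod_apply, ContinuousLinearMap.id_apply, hinclSl, LinearMap.coe_toContinuousLinearMap',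
      Submodule.coe_inclusion, hsX, hζ]
  -- (a) `Q′(H v) = v`: differentiate `Q̄(chart θ_Σ(p)) = p.1`
  have hG : HasStrictFDerivAt (fun Φ : TDir 4 n M => levelQ L N j V₀ (chart (ContinuousLinearMap.id ℝ (Matrix n n ℂ)) M V₀ Φ)) (levelQ' L N j V₀) 0 :=
    hasStrictFDerivAt_levelQ (d := 4) hL1 j hV₀u hV₀PM hx₀0.le (hls j) hV₀x
  have ha : levelQ' L N j V₀ ((fderiv ℝ Ψ 0 v : ↥(skewSub 4 n M)) : TDir 4 n M) = v := by
    have hΘd : HasFDerivAt (fun p : ↥(skewSub 4 n N) × ↥Sl => ((θS p : ↥Sl) : TDir 4 n M)) (Sl.subtypeL.comp (fderiv ℝ θS 0)) 0 :=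
      Sl.subtypeL.hasFDerivAt.comp 0 (hθSc.differentiableAt (by simp)).hasFDerivAt
    have hΘ0 : (fun p : ↥(skewSub 4 n N) × ↥Sl => ((θS p : ↥Sl) : TDir 4 n M)) 0 = 0 := by simp only [hθS0, Submodule.coe_zero]
    have hG' : HasFDerivAt (fun Φ : TDir 4 n M => levelQ L N j V₀ (chart (ContinuousLinearMap.id ℝ (Matrix n n ℂ)) M V₀ Φ)) (levelQ' L N j V₀)
        ((fun p : ↥(skewSub 4 n N) × ↥Sl => ((θS p : ↥Sl) : TDir 4 n M)) 0) := by rw [hΘ0]; exact hG.hasFDerivAt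
    have hF := hG'.comp 0 hΘd
    have hF' : HasFDerivAt (fun p : ↥(skewSub 4 n N) × ↥Sl => levelQ L N j V₀ (chart (ContinuousLinearMap.id ℝ (Matrix n n ℂ)) M V₀ ((θS p : ↥Sl) : TDir 4 n M)))
        (ContinuousLinearMap.fst ℝ ↥(skewSub 4 n N) ↥Sl) 0 :=
      (hasFDerivAt_fst (𝕜 := ℝ) (p := (0 : ↥(skewSub 4 n N) × ↥Sl))).congr_of_eventuallyEq (hfib1.mono fun p hp => hp)
    have h := congrArg (fun T : ↥(skewSub 4 n N) × ↥Sl →L[ℝ] ↥(skewSub 4 n N) => T (v, iK ζ)) (hF.unique hF')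
    simp only [ContinuousLinearMap.comp_apply, Submodule.subtypeL_apply, ContinuousLinearMap.coe_fst'] at h
    rw [hHv, hsX]; exact h
  -- (c) `D²m(0)[v,v] = w·D²𝒜(0)[H v, H v] = w·Σ_p ‖curl (H v)‖²`
  set A : ↥(skewSub 4 n M) → ℝ := fun Φ => fineAction (chart (ContinuousLinearMap.id ℝ (Matrix n n ℂ)) M V₀ (Φ : TDir 4 n M)) W with hA
  have hAc : ContDiffAt ℝ 2 A 0 := by
    have h1 : ContDiffAt ℝ 2 (fun Φ : TDir 4 n M => fineAction (chart (ContinuousLinearMap.id ℝ (Matrix n n ℂ)) M V₀ Φ) W) ((skewSub 4 n M).subtypeL 0) := by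
      rw [map_zero]; exact contDiffAt_fineAction_chart (m := 2) (ContinuousLinearMap.id ℝ (Matrix n n ℂ)) M V₀ W 0
    exact h1.comp 0 (skewSub 4 n M).subtypeL.contDiff.contDiffAt
  have hA0 : A 0 = 0 := by simp only [hA, Submodule.coe_zero, chart_zero, hV₀def, fineAction_flatCfg]
  have hAmin : IsLocalMin A 0 := Filter.Eventually.of_forall fun Φ => by
    rw [hA0]
    show 0 ≤ fineAction (chart (ContinuousLinearMap.id ℝ (Matrix n n ℂ)) M V₀ (Φ : TDir 4 n M)) W
    rw [chart_id_eq_chart_skewP _ Φ.2]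
    exact fineAction_nonneg (isUnitaryCfg_chart M hV₀u _) W
  have hA' : fderiv ℝ A 0 = 0 := hAmin.fderiv_eq_zero
  set ι : ↥(skewSub 4 n N) × ↥KT →L[ℝ] ↥(skewSub 4 n N) × ↥Sl := (ContinuousLinearMap.id ℝ ↥(skewSub 4 n N)).prodMap iK with hι
  set Θ : ↥(skewSub 4 n N) × ↥KT → ↥(skewSub 4 n M) := fun p => inclSl (θS (ι p)) with hΘ
  have hιp : ∀ p : ↥(skewSub 4 n N) × ↥KT, ι p = (p.1, iK p.2) := fun p => rfl
  have hΘval : ∀ p : ↥(skewSub 4 n N) × ↥KT, ((Θ p : ↥(skewSub 4 n M)) : TDir 4 n M) = ((θS (p.1, iK p.2) : ↥Sl) : TDir 4 n M) := fun p => rfl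
  have hgΘ : (fun p : ↥(skewSub 4 n N) × ↥KT => fineAction (chart (ContinuousLinearMap.id ℝ (Matrix n n ℂ)) (L * tower L N j) V₀
      ((θS (p.1, iK p.2) : ↥Sl) : TDir 4 n (L * tower L N j))) (perWin 4 (N * L ^ (j + 1)))) = fun p => A (Θ p) := by
    funext p
    show _ = fineAction (chart (ContinuousLinearMap.id ℝ (Matrix n n ℂ)) M V₀ ((Θ p : ↥(skewSub 4 n M)) : TDir 4 n M)) W
    rw [hΘval p]
  have hΘ0 : Θ 0 = 0 := by simp only [hΘ, map_zero, hθS0]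
  have hΘc : ContDiffAt ℝ 2 Θ 0 := by
    have h1 : ContDiffAt ℝ 2 θS (ι 0) := by rw [map_zero]; exact hθSc
    exact inclSl.contDiff.contDiffAt.comp 0 (h1.comp 0 ι.contDiff.contDiffAt)
  have hΘd : HasFDerivAt Θ (inclSl.comp ((fderiv ℝ θS 0).comp ι)) 0 := by
    have h1 : HasFDerivAt θS (fderiv ℝ θS 0) (ι 0) := by rw [map_zero]; exact (hθSc.differentiableAt (by simp)).hasFDerivAt
    exact inclSl.hasFDerivAt.comp 0 (h1.comp 0 ι.hasFDerivAt)
  have hAcΘ : ContDiffAt ℝ 2 A (Θ 0) := by rw [hΘ0]; exact hAc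
  have hA'Θ : fderiv ℝ A (Θ 0) = 0 := by rw [hΘ0]; exact hA'
  have hD2 := fderiv_fderiv_comp_of_fderiv_eq_zero hAcΘ hΘc hA'Θ (v, ζ) (v, ζ)
  have hTX : fderiv ℝ Θ 0 (v, ζ) = fderiv ℝ Ψ 0 v := by
    rw [hΘd.fderiv, hHv]
    apply Subtype.ext
    simp only [ContinuousLinearMap.comp_apply, hιp, hinclSl, LinearMap.coe_toContinuousLinearMap', Submodule.coe_inclusion, hsX]
  have hc : fderiv ℝ (fderiv ℝ (fun y : ↥(skewSub 4 n N) => minAct 4 (sfClass 4 L N ε) L N (j + 1)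
        (chart (ContinuousLinearMap.id ℝ (Matrix n n ℂ)) N V₀ (y : TDir 4 n N)))) 0 v v
      = w * ∑ p ∈ W, nhsNormSq (curl V₀ (chartDir (ContinuousLinearMap.id ℝ (Matrix n n ℂ)) M ((fderiv ℝ Ψ 0 v : ↥(skewSub 4 n M)) : TDir 4 n M)) p) := by
    rw [hHess v v, hgΘ, hD2, hΘ0, hTX, hV₀def, ← flat_second_variation W (fderiv ℝ Ψ 0 v)]
  refine ⟨ha, ?_, hc⟩
  -- (b) `H v` attains the minimum
  rw [← hc]
  exact hleast v

end

end Summit.QuantumFields.BalabanUV.T4Continuum.NE7MinimiserDerivativeFlat
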